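import Mathlib
import HarnessLib
import Literature.MathematicalPhysics.QuantumLattice.ScaleZeroAngularFactor
import Literature.MathematicalPhysics.QuantumLattice.ScaleZeroMultiplierJoint
import Literature.MathematicalPhysics.QuantumLattice.HubbardScaleZeroSectorSymbolGeometry
import Summits.HubbardSuperconductivity.HubbardSuperconductivity.Theorems.KLProgrammeKLRegimeEngineScaleZeroE4Bands
import Summits.HubbardSuperconductivity.HubbardSuperconductivity.Theorems.KLProgrammeKLRegimeEngineScaleZeroSymbol
import Summits.HubbardSuperconductivity.HubbardSuperconductivity.Theorems.KLProgrammeKLRegimeEngineFramePosKernelBound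

/-!
# KL programme (k = 3, c = 2, p1 g3) — ENGINE (E4)₀: the scale-`0` sector multiplier as a centred-sampled telescoped symbol
# (`T_X`, part 1: bands at the centred momenta, identification, boundary bands, angular products)

Helpers toward the item `KLRegimeEngineV16` (conjunct (E4)₀ of `stub_engine_scale0`), for the SPACE first moment `T_X` of the
scale-`0` multiplier torus sum `hT` of `firstMoment_zero_le_of_torusSums`.  The multiplier
`F_ω(k) = H₀(ν_{k₀}² + e_K(k⃗)²)·ζ̃_{0,ω}(θ(k⃗))` (`klAnisoFamily_zero_apply`) is rewritten as the CENTRED-sampled product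
`M_ℂ(ν, b_{N+1}(c⃗(k⃗)))·Ã_ω(c⃗(k⃗))` with the partial frame bands `bₘ` of `…ScaleZeroE4Bands`, the plane cutoff `bgmCutoff₂ klE0` and the
smoothed angular factor `scaleZeroAngular ω` (Literature `ScaleZeroAngularFactor`: `= ζ̃∘θ` off the unit disc, and on the shell
`|e_K| < e₀` one has `‖c⃗‖ ≥ 1`):

* `frameBandSeq_centred_eq` — `bₘ(c⃗(k⃗)) = bₘ(p(k⃗))` (periodicity);
* **`klAnisoFamily_zero_eq_centred`** — the identification;
* **`frameBandInterp_far`** — near the zone boundary (`cos p_l ≤ −cos(4π/L)` for some `l`) every interpolated partial band is `> klE0`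
  (`μ ∈ klWindowC`, `(16/15)Gfr0|U| ≤ 1/50`, `2^15 ≤ L`);
* **`norm_iteratedFDeriv_framePiece_mul_angular_le`** — `‖Dⁱ[(−Kₘ)·Ã_ω]‖ ≤ C_A·Σ_{j≤i} C(i,j)·Gfr_j·uPow_j U·(2^m)^{2j}/(2^m)^4`.
-/

noncomputable section

namespace Summit.HubbardSuperconductivity.HubbardSuperconductivity.Theorems.EngineV8

set_option linter.dupNamespace false -- summit = problem name (single-conjunct summit), D-0017

open Real Finset Literature.MathematicalPhysics.QuantumLattice Literature.Probability.LatticeModels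
open Summit.HubbardSuperconductivity.HubbardSuperconductivity.Theorems.KLRegimeSplit
open Summit.HubbardSuperconductivity.HubbardSuperconductivity.Theorems.DispersionFlow
open Summit.HubbardSuperconductivity.HubbardSuperconductivity.Theorems.ScaleZeroDecay
open Literature.MathematicalPhysics.QuantumLattice.FermiRG
open Summit.HubbardSuperconductivity.HubbardSuperconductivity.Theorems.KLProgrammeLegKernels
open scoped Nat

variable {L M : ℕ}

/-! ## §1 Bands at the centred momenta -/

/-- The lattice momentum is the centred momentum plus a lattice vector of `2πℤ²`. -/
theorem latticeMomentum_eq_centred_add [NeZero L] (k : TorusSite 2 L) :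
    latticeMomentum L k = fun i => torusCentredMomentum L k i +
      (toIocDiv Real.two_pi_pos (-Real.pi) (latticeMomentum L k i) : ℝ) * (2 * Real.pi) := by
  funext i
  have h := toIocMod_add_toIocDiv_zsmul Real.two_pi_pos (-Real.pi) (latticeMomentum L k i)
  rw [zsmul_eq_mul] at h
  rw [torusCentredMomentum]
  linarith

/-- **The partial bands at the centred momentum equal those at the lattice momentum.** -/
theorem frameBandSeq_centred_eq [NeZero L] (μ : ℝ) (Kp : ℕ → TrigPolyC4v) (m : ℕ) (k : TorusSite 2 L) :
    (fun q : EuclideanSpace ℝ (Fin 2) => frameLevel μ 0 q - ∑ n ∈ range m, evalM (Kp n) q)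
        (WithLp.toLp 2 (torusCentredMomentum L k)) =
      (fun q : EuclideanSpace ℝ (Fin 2) => frameLevel μ 0 q - ∑ n ∈ range m, evalM (Kp n) q)
        (WithLp.toLp 2 (latticeMomentum L k)) := by
  rw [latticeMomentum_eq_centred_add k, frameBandSeq_periodic]

/-- **The lattice band at the centred momentum**: `e_K(k⃗) = b_{N+1}(c⃗(k⃗))`. -/
theorem nambuXiCT_eq_frameBandSeq_centred [NeZero L] (μ : ℝ) {K : TrigPolyC4v} {Kp : ℕ → TrigPolyC4v} {N : ℕ}
    (hsum : ∀ p : Fin 2 → ℝ, K.eval p = ∑ n ∈ range (N + 1), (Kp n).eval p) (k : TorusSite 2 L) :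
    nambuXiCT L μ K k = (fun q : EuclideanSpace ℝ (Fin 2) => frameLevel μ 0 q - ∑ n ∈ range (N + 1), evalM (Kp n) q)
        (WithLp.toLp 2 (torusCentredMomentum L k)) := by
  rw [frameBandSeq_centred_eq, nambuXiCT_eq_frameBandSeq_last μ hsum]

/-! ## §2 The identification of the scale-`0` multiplier -/

/-- **On the shell the centred momentum is long**: `|e_K(k⃗)| < klE0`, `|K| ≤ 1/50`, `μ ≥ −1.05` ⇒ `1 ≤ ‖c⃗(k⃗)‖`. -/
theorem one_le_norm_centred_of_shell [NeZero L] {R : RenConsts} {U : ℝ} {N : ℕ} {μ : ℝ} {K : TrigPolyC4v}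
    (hK : FrameOK R U N μ K) (hR : ∀ j, 0 ≤ R.Gfr j) (hμ : μ ∈ klWindowC) (hκU : 16 / 15 * (R.Gfr 0 * |U|) ≤ 1 / 50)
    (k : TorusSite 2 L) (h : |nambuXiCT L μ K k| < klE0) :
    1 ≤ ‖(WithLp.toLp 2 (torusCentredMomentum L k) : EuclideanSpace ℝ (Fin 2))‖ := by
  have hKκ := abs_eval_le_of_frameOK hK hR
  obtain ⟨hμ1, _⟩ := hμ
  have hr : (1 : ℝ) ^ 2 ≤ 4 + μ - 16 / 15 * (R.Gfr 0 * |U|) - klE0 := by norm_num [klE0] at hμ1 ⊢; linarith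
  have h1 := le_norm_centred_of_abs_nambuXiCT_lt hKκ hr k h
  rwa [← norm_momToComplex_ofLp, WithLp.ofLp_toLp]

/-- **The scale-`0` multiplier is the centred-sampled product** `M_ℂ(ν_{k₀}, b_{N+1}(c⃗(k⃗)))·Ã_ω(c⃗(k⃗))`. -/
theorem klAnisoFamily_zero_eq_centred [NeZero L] [NeZero M] {R : RenConsts} {U : ℝ} {N : ℕ} {μ : ℝ} {K : TrigPolyC4v}
    (hK : FrameOK R U N μ K) (hR : ∀ j, 0 ≤ R.Gfr j) (hμ : μ ∈ klWindowC) (hκU : 16 / 15 * (R.Gfr 0 * |U|) ≤ 1 / 50)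
    {Kp : ℕ → TrigPolyC4v} (hsum : ∀ p : Fin 2 → ℝ, K.eval p = ∑ n ∈ range (N + 1), (Kp n).eval p)
    (β : ℝ) (ω : Fin (sectorCount 0)) (k : FreqMomentum L M) :
    klAnisoFamily L M β μ K klE0 0 ω k =
      ((bgmCutoff₂ klE0 (fbPt (matsubaraFreq β M k.1)
          ((fun q : EuclideanSpace ℝ (Fin 2) => frameLevel μ 0 q - ∑ n ∈ range (N + 1), evalM (Kp n) q)
            (WithLp.toLp 2 (torusCentredMomentum L k.2)))) : ℝ) : ℂ) *
        ((scaleZeroAngular ω (WithLp.toLp 2 (torusCentredMomentum L k.2)) : ℝ) : ℂ) := by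
  have he : (klE0 : ℝ) ≠ 0 := by norm_num [klE0]
  have he0 : (0 : ℝ) < klE0 := by norm_num [klE0]
  rw [klAnisoFamily_zero_apply, ← nambuXiCT_eq_frameBandSeq_centred μ hsum, bgmCutoff₂_apply he, fbPt_apply_zero, fbPt_apply_one,
    ← Complex.ofReal_mul]
  congr 1
  by_cases h : |nambuXiCT L μ K k.2| < klE0
  · rw [scaleZeroAngular_eq_of_le _ (one_le_norm_centred_of_shell hK hR hμ hκU k.2 h), WithLp.ofLp_toLp, momentumAngle]
  · -- off the shell the cutoff vanishes
    have hx : klE0 ≤ ‖fbPt (matsubaraFreq β M k.1) (nambuXiCT L μ K k.2)‖ := by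
      have h2 := norm_sq_freqBand (fbPt (matsubaraFreq β M k.1) (nambuXiCT L μ K k.2))
      rw [fbPt_apply_zero, fbPt_apply_one] at h2
      have h3 : klE0 ^ 2 ≤ ‖fbPt (matsubaraFreq β M k.1) (nambuXiCT L μ K k.2)‖ ^ 2 := by
        rw [h2]; nlinarith [sq_abs (nambuXiCT L μ K k.2), abs_nonneg (nambuXiCT L μ K k.2), not_lt.1 h, sq_nonneg (matsubaraFreq β M k.1)]
      nlinarith [norm_nonneg (fbPt (matsubaraFreq β M k.1) (nambuXiCT L μ K k.2))]
    have hz := bgmCutoff₂_eq_zero_of_le he0 hx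
    rw [bgmCutoff₂_apply he, fbPt_apply_zero, fbPt_apply_one] at hz
    rw [hz, zero_mul, zero_mul]

/-! ## §3 The interpolated partial bands are large near the zone boundary -/

/-- `cos(4π/L) ≥ 99/100` for `2^15 ≤ L`. -/
theorem cos_four_pi_div_ge (hL : (2 : ℝ) ^ 15 ≤ L) : 99 / 100 ≤ Real.cos (4 * Real.pi / L) := by
  have hLpos : (0 : ℝ) < L := lt_of_lt_of_le (by norm_num) hL
  have hπ4 : Real.pi < 3.1416 := Real.pi_lt_d4
  have hx : 4 * Real.pi / L ≤ 1 / 2 ^ 11 := by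
    rw [div_le_iff₀ hLpos]
    calc 4 * Real.pi ≤ 2 ^ 4 := by linarith
      _ = 1 / 2 ^ 11 * 2 ^ 15 := by norm_num
      _ ≤ 1 / 2 ^ 11 * L := by gcongr
  have hx0 : 0 ≤ 4 * Real.pi / L := by positivity
  have h := Real.one_sub_sq_div_two_le_cos (x := 4 * Real.pi / L)
  nlinarith

/-- **Interpolated partial bands near the zone boundary**: for `p` with `cos p_l ≤ −cos(4π/L)` for some `l`, every
`bₘ(p) + s·(−Kₘ(p))` (`m ≤ N`, `s ∈ [0,1]`) exceeds `klE0` in absolute value. -/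
theorem frameBandInterp_far {R : RenConsts} {U : ℝ} {N : ℕ} {μ : ℝ} {K : TrigPolyC4v}
    (hK : FrameOK R U N μ K) (hR : ∀ j, 0 ≤ R.Gfr j) (hμ : μ ∈ klWindowC) (hκU : 16 / 15 * (R.Gfr 0 * |U|) ≤ 1 / 50)
    (hL : (2 : ℝ) ^ 15 ≤ L) {Kp : ℕ → TrigPolyC4v}
    (hS : ∀ n ≤ N, ∀ j ≤ 4, ∀ q, ‖iteratedFDeriv ℝ j (evalM (Kp n)) q‖ ≤ R.Gfr j * uPow j U * (4 : ℝ) ^ (((j : ℤ) - 2) * n))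
    {m : ℕ} (hm : m ≤ N) {s : ℝ} (hs : s ∈ Set.Icc (0 : ℝ) 1) (p : Fin 2 → ℝ)
    (hp : ∃ l : Fin 2, Real.cos (p l) ≤ -Real.cos (4 * Real.pi / L)) :
    klE0 < |(fun q : EuclideanSpace ℝ (Fin 2) => frameLevel μ 0 q - ∑ n ∈ range m, evalM (Kp n) q) (WithLp.toLp 2 p) +
      s * (fun q : EuclideanSpace ℝ (Fin 2) => -evalM (Kp m) q) (WithLp.toLp 2 p)| := by
  have _hK := hK
  obtain ⟨hμ1, hμ2⟩ := hμ
  have hcos := cos_four_pi_div_ge (L := L) hL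
  -- the free band
  have hfree : frameLevel μ 0 (WithLp.toLp 2 p) = -2 * (Real.cos (p 0) + Real.cos (p 1)) - μ := by
    rw [frameLevel_toLp_eq_ctBandFn, ctBandFn, TrigPolyC4v.eval_zero, sub_zero]
  have hfree_ge : 2 * Real.cos (4 * Real.pi / L) - 2 - μ ≤ frameLevel μ 0 (WithLp.toLp 2 p) := by
    rw [hfree]
    obtain ⟨l, hl⟩ := hp
    have h0 := Real.cos_le_one (p 0)
    have h1 := Real.cos_le_one (p 1)
    fin_cases l
    · simp only [Fin.zero_eta, Fin.isValue] at hl; linarith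
    · simp only [Fin.mk_one, Fin.isValue] at hl; linarith
  -- the pieces
  have hpiece : ∀ n ≤ N, |evalM (Kp n) (WithLp.toLp 2 p)| ≤ R.Gfr 0 * uPow 0 U * (4 : ℝ) ^ (((0 : ℤ) - 2) * n) := by
    intro n hn
    have h := hS n hn 0 (by norm_num) (WithLp.toLp 2 p)
    rwa [norm_iteratedFDeriv_zero, Real.norm_eq_abs] at h
  have hsum : |∑ n ∈ range m, evalM (Kp n) (WithLp.toLp 2 p) + s * evalM (Kp m) (WithLp.toLp 2 p)| ≤ 16 / 15 * (R.Gfr 0 * |U|) := by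
    have hs0 := hs.1
    have hs1 := hs.2
    calc |∑ n ∈ range m, evalM (Kp n) (WithLp.toLp 2 p) + s * evalM (Kp m) (WithLp.toLp 2 p)|
        ≤ ∑ n ∈ range m, |evalM (Kp n) (WithLp.toLp 2 p)| + |s * evalM (Kp m) (WithLp.toLp 2 p)| :=
          (abs_add_le _ _).trans (add_le_add (abs_sum_le_sum_abs _ _) le_rfl)
      _ ≤ ∑ n ∈ range m, |evalM (Kp n) (WithLp.toLp 2 p)| + |evalM (Kp m) (WithLp.toLp 2 p)| := by
          rw [abs_mul, abs_of_nonneg hs0]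
          exact add_le_add le_rfl (mul_le_of_le_one_left (abs_nonneg _) hs1)
      _ = ∑ n ∈ range (m + 1), |evalM (Kp n) (WithLp.toLp 2 p)| := by rw [sum_range_succ]
      _ ≤ ∑ n ∈ range (N + 1), |evalM (Kp n) (WithLp.toLp 2 p)| :=
          sum_le_sum_of_subset_of_nonneg (range_subset_range.2 (by omega)) fun _ _ _ => abs_nonneg _
      _ ≤ ∑ n ∈ range (N + 1), R.Gfr 0 * uPow 0 U * (4 : ℝ) ^ (((0 : ℤ) - 2) * n) :=
          sum_le_sum fun n hn => hpiece n (Nat.lt_succ_iff.1 (mem_range.1 hn))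
      _ ≤ 16 / 15 * (R.Gfr 0 * |U|) := allowanceSum_zero_le hR U N
  have hval : (fun q : EuclideanSpace ℝ (Fin 2) => frameLevel μ 0 q - ∑ n ∈ range m, evalM (Kp n) q) (WithLp.toLp 2 p) +
      s * (fun q : EuclideanSpace ℝ (Fin 2) => -evalM (Kp m) q) (WithLp.toLp 2 p) =
      frameLevel μ 0 (WithLp.toLp 2 p) - (∑ n ∈ range m, evalM (Kp n) (WithLp.toLp 2 p) + s * evalM (Kp m) (WithLp.toLp 2 p)) := by
    simp only; ring
  rw [hval]
  have hE : (klE0 : ℝ) = 1 / 32 := by norm_num [klE0]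
  have hlow := (abs_le.1 hsum).2
  refine lt_of_lt_of_le ?_ (le_abs_self _)
  rw [hE]
  linarith

/-! ## §4 The angular products `(−Kₘ)·Ã_ω` -/

/-- **Leibniz for a frame piece times the smoothed angular factor**:
`‖Dⁱ[(−Kₘ)·Ã_ω](x)‖ ≤ C_A·Σ_{j≤i} C(i,j)·Gfr_j·uPow_j U·(2^m)^{2j}/(2^m)^4` (`i ≤ 3`, `m ≤ N`). -/
theorem norm_iteratedFDeriv_framePiece_mul_angular_le {R : RenConsts} {U : ℝ} {N : ℕ} {Kp : ℕ → TrigPolyC4v}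
    (hS : ∀ n ≤ N, ∀ j ≤ 4, ∀ q, ‖iteratedFDeriv ℝ j (evalM (Kp n)) q‖ ≤ R.Gfr j * uPow j U * (4 : ℝ) ^ (((j : ℤ) - 2) * n))
    {m : ℕ} (hm : m ≤ N) (ω : ℤ) {CA : ℝ}
    (hCA : ∀ i ≤ 3, ∀ x, ‖iteratedFDeriv ℝ i (scaleZeroAngular ω) x‖ ≤ CA) {i : ℕ} (hi : i ≤ 3) (x : EuclideanSpace ℝ (Fin 2)) :
    ‖iteratedFDeriv ℝ i (fun x => (fun q : EuclideanSpace ℝ (Fin 2) => -evalM (Kp m) q) x * scaleZeroAngular ω x) x‖ ≤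
      CA * ∑ j ∈ range (i + 1), (i.choose j : ℝ) * (R.Gfr j * uPow j U * (((2 : ℝ) ^ m) ^ (2 * j) / ((2 : ℝ) ^ m) ^ 4)) := by
  have hf : ContDiff ℝ i (fun q : EuclideanSpace ℝ (Fin 2) => -evalM (Kp m) q) := contDiff_evalM_neg (Kp m)
  have hg : ContDiff ℝ i (scaleZeroAngular ω) := contDiff_scaleZeroAngular ω
  have h := norm_iteratedFDeriv_mul_le hf hg x (n := i) (by exact_mod_cast le_rfl)
  refine h.trans ?_
  rw [mul_sum]
  refine sum_le_sum fun j hj => ?_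
  have hji : j ≤ i := Nat.lt_succ_iff.1 (mem_range.1 hj)
  have h1 := norm_iteratedFDeriv_framePiece_le hS hm (i := j) (by omega) x
  have h2 := hCA (i - j) (by omega) x
  have hW0 : 0 ≤ R.Gfr j * uPow j U * (((2 : ℝ) ^ m) ^ (2 * j) / ((2 : ℝ) ^ m) ^ 4) := le_trans (norm_nonneg _) h1
  calc (i.choose j : ℝ) * ‖iteratedFDeriv ℝ j (fun q : EuclideanSpace ℝ (Fin 2) => -evalM (Kp m) q) x‖ *
        ‖iteratedFDeriv ℝ (i - j) (scaleZeroAngular ω) x‖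
      ≤ (i.choose j : ℝ) * (R.Gfr j * uPow j U * (((2 : ℝ) ^ m) ^ (2 * j) / ((2 : ℝ) ^ m) ^ 4)) * CA :=
        mul_le_mul (mul_le_mul_of_nonneg_left h1 (by positivity)) h2 (norm_nonneg _) (by positivity)
    _ = CA * ((i.choose j : ℝ) * (R.Gfr j * uPow j U * (((2 : ℝ) ^ m) ^ (2 * j) / ((2 : ℝ) ^ m) ^ 4))) := by ring

end Summit.HubbardSuperconductivity.HubbardSuperconductivity.Theorems.EngineV8

end
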